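import Summits.ResolutionOfSingularities.ResolutionOfSingularities.Theorems.PurelyInseparableDim4HopRegionsLocalEscape
import Summits.ResolutionOfSingularities.ResolutionOfSingularities.Theorems.PurelyInseparableDim4LoopCLocalEscapeUniform
import HarnessLib

/-!
# [OURS · res-dim4-pi · F4-C-loc] ALL-FIELDS LIFT of the local escapes of the hunt regions F1, F2 and of the one-component
  states of F3: over EVERY field of characteristic 3 these states are IMMEDIATE local A-wins — the maximal-dimensional
  component has NO equimultiple point over the current point at all (maximal witnesses in every chart)

Cell `res-dim4-pi` (D-0157 DOOR 2, wave 2), seat `res-dim4-p-6` g2, desk WORD #66 (3) («all-fields lift of the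
LOOP-D/E/F1–F3 local wins — GO»).  Tool: `UniformNoReply` (p667095); pattern: `…LoopCLocalEscapeUniform` (p667375).

* §1 `rWins_allFields_of_witnesses` — generic: a presented state over `𝔽₃` in scope, a permissible centre `S`, and a
  MAXIMAL WITNESS for every chart `j ∈ S` (translated coordinates `S ∖ {j}`) ⇒ over EVERY field `L` of
  characteristic 3 the lifted state is an A-win of the LOCAL in-scope game in ONE move (B has no reply).
* §2 the witnesses (‖ K by `decide +kernel` on res-dim4-p-8 g2's literal data of `…HopRegions`): F1 `fa0/fa1/fa2`
  (`faL0` under the line `V(x₁,x₂,x₄)`: `x₂x₄ / x₁x₄ / x₁x₂`; `faL1` under `V(x₁,x₃)`: `x₃ / x₁²`), F2 `fb0/fb1/fb2`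
  (`x₂x₄ / x₁x₄ / x₁x₂`; `x₃² / x₁`), F3 one-component states `fc1` (`fcL5`, `V(x₂,x₄)`: `x₄² / x₂`), `fc2` (`fcL1`,
  `V(x₁,x₄)`: `x₄² / x₁`), `fc5` (`fcL4`: `x₄² / x₁`), `fc4`/`fc6` (`fcL3`, line `V(x₁,x₂,x₃)`: `x₂x₃ / x₁x₃ / x₁x₂`).
* §3 **`f1_localWins_allFields`**, **`f2_localWins_allFields`** (the whole regions F1, F2 over every field of
  characteristic 3), `fc1/fc2/fc4/fc5/fc6_localWin_allFields`.
* §4 WHAT DOES NOT LIFT THIS WAY (honest): LOOP-D's line states and F3's `fc0`/`fc3` have charts with TWO free fibre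
  coordinates or `β`-dependent low-degree coefficients; and LOOP-E's `e3` is a genuine obstruction — its only low-degree
  coefficient is `β²(1 + β²)`, so over `𝔽₉` the points `β = ±i` ARE equimultiple (bus 21:23Z K-datum; kernel form
  pending) — the `𝔽₃`-rational rider on those rows is real, not an artefact of the method.

Scope (honest): statements about OUR frame's LOCAL game; nothing here decides F4-C-loc(3,3); NOTHING here is a statement
about resolution of singularities — resolution in dimension `≥ 4` / characteristic `p > 0` is NOT proved by anything in
this file.  [OURS · counted 0 · kernel certificates + symbolic coefficient law; AI kernel work, weaker than expert review.]
bears_on: LADDER-RESOLUTION:D157-DOOR2 (res-dim4-pi · F4-C-loc(3,3) all fields · F1/F2/F3).  Host item (DR-157-C):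
`stmt-ResolutionOfSingularities-16155`, helper.
-/

set_option linter.dupNamespace false -- mandated namespace of this single-conjunct summit

noncomputable section

open MvPolynomial Finset

namespace Summit.ResolutionOfSingularities.ResolutionOfSingularities.Theorems.PIDim4

namespace LoopCLocal

open Literature.AlgebraicGeometry.Resolution
open Literature.AlgebraicGeometry.Resolution.CentreBlowup
open StepKit LoopC UniformNoReply

/-! ## §1 One move, no reply — over every field -/

/-- **Immediate local win over every field of characteristic 3**: a presented state over `𝔽₃` in coordinate scope, a
permissible centre `S`, and for every chart `j ∈ S` a MAXIMAL WITNESS for the translation class `S ∖ {j}` ⇒ the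
lifted state is an A-win of the LOCAL in-scope game over EVERY field `L` of characteristic `3` (play `S`; B has no
equimultiple `L`-point over the current point). OURS. [folklore] -/
theorem rWins_allFields_of_witnesses (L : Type) [Field L] [CharP L 3] [DecidableEq L] {s : SData 4 (ZMod 3)}
    {S : Finset (Fin 4)} (hscope : InCoordinateScope 3 s.toState.F) (hperm : permB 3 S s.L = true)
    (w : Fin 4 → Fin 4 → ℕ) (hw : ∀ j ∈ S, uniformWitnessB 3 S j (S.erase j) s.L (w j) = true) :
    RWins 3 localB (liftState L s.toState) :=
  Game.Wins.move (m := S) (legal_lift L hscope hperm)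
    fun _ ⟨j, b, hj, hbj, hloc, heq, _, _⟩ =>
      absurd heq (not_isEquimultiplePoint_of_uniformWitnessB (φ3 L) (hw j hj)
        (vanish_erase L hbj ((localB_eq_true_iff _ j b).mp hloc)))

/-! ## §2 The witnesses (‖ K over `𝔽₃`) -/

/-- F1/F2 root shape `faL0`/`fbL0` under the line `V(x₁,x₂,x₄)`: witnesses `x₂x₄`, `x₁x₄`, `x₁x₂`. [OURS · ‖ K] -/
theorem w_faL0 : ∀ j ∈ ({0, 1, 3} : Finset (Fin 4)),
    uniformWitnessB 3 {0, 1, 3} j (({0, 1, 3} : Finset (Fin 4)).erase j) faL0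
      (![![0, 1, 0, 1], ![1, 0, 0, 1], ![0, 0, 0, 0], ![1, 1, 0, 0]] j) = true := by decide +kernel

/-- `faL1` under `V(x₁,x₃)`: witnesses `x₃` (x₁-chart), `x₁²` (x₃-chart). [OURS · ‖ K] -/
theorem w_faL1 : ∀ j ∈ ({0, 2} : Finset (Fin 4)),
    uniformWitnessB 3 {0, 2} j (({0, 2} : Finset (Fin 4)).erase j) faL1
      (![![0, 0, 1, 0], ![0, 0, 0, 0], ![2, 0, 0, 0], ![0, 0, 0, 0]] j) = true := by decide +kernel

/-- `fbL0` under `V(x₁,x₂,x₄)`: witnesses `x₂x₄`, `x₁x₄`, `x₁x₂`. [OURS · ‖ K] -/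
theorem w_fbL0 : ∀ j ∈ ({0, 1, 3} : Finset (Fin 4)),
    uniformWitnessB 3 {0, 1, 3} j (({0, 1, 3} : Finset (Fin 4)).erase j) fbL0
      (![![0, 1, 0, 1], ![1, 0, 0, 1], ![0, 0, 0, 0], ![1, 1, 0, 0]] j) = true := by decide +kernel

/-- `fbL1` under `V(x₁,x₃)`: witnesses `x₃²`, `x₁`. [OURS · ‖ K] -/
theorem w_fbL1 : ∀ j ∈ ({0, 2} : Finset (Fin 4)),
    uniformWitnessB 3 {0, 2} j (({0, 2} : Finset (Fin 4)).erase j) fbL1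
      (![![0, 0, 2, 0], ![0, 0, 0, 0], ![1, 0, 0, 0], ![0, 0, 0, 0]] j) = true := by decide +kernel

/-- `fcL1` under `V(x₁,x₄)`: witnesses `x₄²`, `x₁`. [OURS · ‖ K] -/
theorem w_fcL1 : ∀ j ∈ ({0, 3} : Finset (Fin 4)),
    uniformWitnessB 3 {0, 3} j (({0, 3} : Finset (Fin 4)).erase j) fcL1
      (![![0, 0, 0, 2], ![0, 0, 0, 0], ![0, 0, 0, 0], ![1, 0, 0, 0]] j) = true := by decide +kernel

/-- `fcL4` under `V(x₁,x₄)`: witnesses `x₄²`, `x₁`. [OURS · ‖ K] -/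
theorem w_fcL4 : ∀ j ∈ ({0, 3} : Finset (Fin 4)),
    uniformWitnessB 3 {0, 3} j (({0, 3} : Finset (Fin 4)).erase j) fcL4
      (![![0, 0, 0, 2], ![0, 0, 0, 0], ![0, 0, 0, 0], ![1, 0, 0, 0]] j) = true := by decide +kernel

/-- `fcL5` under `V(x₂,x₄)`: witnesses `x₄²`, `x₂`. [OURS · ‖ K] -/
theorem w_fcL5 : ∀ j ∈ ({1, 3} : Finset (Fin 4)),
    uniformWitnessB 3 {1, 3} j (({1, 3} : Finset (Fin 4)).erase j) fcL5
      (![![0, 0, 0, 0], ![0, 0, 0, 2], ![0, 0, 0, 0], ![0, 1, 0, 0]] j) = true := by decide +kernel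

/-- `fcL3` under the line `V(x₁,x₂,x₃)`: witnesses `x₂x₃`, `x₁x₃`, `x₁x₂`. [OURS · ‖ K] -/
theorem w_fcL3 : ∀ j ∈ ({0, 1, 2} : Finset (Fin 4)),
    uniformWitnessB 3 {0, 1, 2} j (({0, 1, 2} : Finset (Fin 4)).erase j) fcL3
      (![![0, 1, 1, 0], ![1, 0, 1, 0], ![1, 1, 0, 0], ![0, 0, 0, 0]] j) = true := by decide +kernel

/-! ## §3 The lifts -/

section AllFields

variable (L : Type) [Field L] [CharP L 3] [DecidableEq L]

/-- F1 root `fa0` over every field of characteristic 3: immediate local win (line `V(x₁,x₂,x₄)`). [OURS · ‖ K] -/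
theorem fa0_localWin_allFields : RWins 3 localB (liftState L fa0.toState) :=
  rWins_allFields_of_witnesses L (inCoordinateScope_toState_of_scopeCertB scope_faL0) (by decide +kernel) _ w_faL0
/-- F1 `fa1` (plane `V(x₁,x₃)`). [OURS · ‖ K] -/
theorem fa1_localWin_allFields : RWins 3 localB (liftState L fa1.toState) :=
  rWins_allFields_of_witnesses L (inCoordinateScope_toState_of_scopeCertB scope_faL1) (by decide +kernel) _ w_faL1
/-- F1 `fa2`. [OURS · ‖ K] -/
theorem fa2_localWin_allFields : RWins 3 localB (liftState L fa2.toState) :=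
  rWins_allFields_of_witnesses L (inCoordinateScope_toState_of_scopeCertB scope_faL0) (by decide +kernel) _ w_faL0

/-- **F1 lifts: the whole region is no local play over EVERY field of characteristic 3.** [OURS · ‖ K] -/
theorem f1_localWins_allFields : ∀ s ∈ trapSet faR, RWins 3 localB (liftState L s) := by
  rintro s ⟨sw, hsw, rfl⟩
  simp only [faR, List.mem_cons, List.not_mem_nil, or_false] at hsw
  rcases hsw with rfl | rfl | rfl
  · exact fa0_localWin_allFields L
  · exact fa1_localWin_allFields L
  · exact fa2_localWin_allFields L

/-- F2 root `fb0` (line `V(x₁,x₂,x₄)`). [OURS · ‖ K] -/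
theorem fb0_localWin_allFields : RWins 3 localB (liftState L fb0.toState) :=
  rWins_allFields_of_witnesses L (inCoordinateScope_toState_of_scopeCertB scope_fbL0) (by decide +kernel) _ w_fbL0
/-- F2 `fb1` (plane `V(x₁,x₃)`). [OURS · ‖ K] -/
theorem fb1_localWin_allFields : RWins 3 localB (liftState L fb1.toState) :=
  rWins_allFields_of_witnesses L (inCoordinateScope_toState_of_scopeCertB scope_fbL1) (by decide +kernel) _ w_fbL1
/-- F2 `fb2`. [OURS · ‖ K] -/
theorem fb2_localWin_allFields : RWins 3 localB (liftState L fb2.toState) :=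
  rWins_allFields_of_witnesses L (inCoordinateScope_toState_of_scopeCertB scope_fbL0) (by decide +kernel) _ w_fbL0

/-- **F2 lifts: the whole region is no local play over EVERY field of characteristic 3.** [OURS · ‖ K] -/
theorem f2_localWins_allFields : ∀ s ∈ trapSet fbR, RWins 3 localB (liftState L s) := by
  rintro s ⟨sw, hsw, rfl⟩
  simp only [fbR, List.mem_cons, List.not_mem_nil, or_false] at hsw
  rcases hsw with rfl | rfl | rfl
  · exact fb0_localWin_allFields L
  · exact fb1_localWin_allFields L
  · exact fb2_localWin_allFields L

/-- F3 `fc1` (`fcL5`, plane `V(x₂,x₄)`) over every field of characteristic 3. [OURS · ‖ K] -/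
theorem fc1_localWin_allFields : RWins 3 localB (liftState L fc1.toState) :=
  rWins_allFields_of_witnesses L (inCoordinateScope_toState_of_scopeCertB scope_fcL5) (by decide +kernel) _ w_fcL5
/-- F3 `fc2` (`fcL1`, plane `V(x₁,x₄)`). [OURS · ‖ K] -/
theorem fc2_localWin_allFields : RWins 3 localB (liftState L fc2.toState) :=
  rWins_allFields_of_witnesses L (inCoordinateScope_toState_of_scopeCertB scope_fcL1) (by decide +kernel) _ w_fcL1
/-- F3 `fc4` (`fcL3`, line `V(x₁,x₂,x₃)`). [OURS · ‖ K] -/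
theorem fc4_localWin_allFields : RWins 3 localB (liftState L fc4.toState) :=
  rWins_allFields_of_witnesses L (inCoordinateScope_toState_of_scopeCertB scope_fcL3) (by decide +kernel) _ w_fcL3
/-- F3 `fc5` (`fcL4`, plane `V(x₁,x₄)`). [OURS · ‖ K] -/
theorem fc5_localWin_allFields : RWins 3 localB (liftState L fc5.toState) :=
  rWins_allFields_of_witnesses L (inCoordinateScope_toState_of_scopeCertB scope_fcL4) (by decide +kernel) _ w_fcL4
/-- F3 `fc6` (`fcL3`). [OURS · ‖ K] -/
theorem fc6_localWin_allFields : RWins 3 localB (liftState L fc6.toState) :=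
  rWins_allFields_of_witnesses L (inCoordinateScope_toState_of_scopeCertB scope_fcL3) (by decide +kernel) _ w_fcL3

end AllFields

end LoopCLocal

end Summit.ResolutionOfSingularities.ResolutionOfSingularities.Theorems.PIDim4

end
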